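/-
Copyright (c) 2026 the pub-hodgecm-mathlib formalisation cell (harness21).  Prover seat hodgecm-mathlib-K2-defs1 (g6), Track B, h413 = `stmt-HodgeConjecture-24833`, route `HCCMUnconditional`,
deal (235)(a) of dealer K2E1-plan (g7) 2026-09-04T12:44:32Z (K2E1-p11's FILE 2, split 2a∕2b of my 12:53Z plan): the ARCH GAUGE test function and its self-convolution as a pure tensor.
-/
import Summits.HodgeConjecture.HodgeConjecture.Theorems.K2E1SphericalTestFunctionGL       -- ★ P5c FILE A: `exists_norm_le_of_hsQ_le`; brings ★ `archBump` (Literature `AutomorphicRepsGLCuspidalL2Step1Bump`), `adelicWeight`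
import Summits.HodgeConjecture.HodgeConjecture.Theorems.K2E1ChiHeckeArchScalarU2         -- ★ 12d-C (this seat): the `hten`∕`hcent`∕`hU` currency (`archPart`, comap subgroups)
import Summits.HodgeConjecture.HodgeConjecture.Theorems.K2E1BLSelfConvolutionU2          -- ★ self-convolution API on `U(J_N)(𝔸_F)`
import HarnessLib

/-!
# (235)(a) FILE 2a∕2b — `K2E1ArchPureTensorSelfConvolutionU2`: THE ARCHIMEDEAN GAUGE TEST FUNCTION `η = α_φ ⊗ 𝟙_{U₀}` (`α_φ(x) = φ(Q(x−1))φ(Q(x⁻¹−1))`, ★ `archBump`) ON `GL_N(𝔸_E)`, AND ITS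
# SELF-CONVOLUTION ON `U(J_N)(𝔸_F)` AS THE PURE TENSOR `κ·μ_f(U)·(α∗α) ⊗ 𝟙_U` — 12d-C's binders `hten`, `hcent` DISCHARGED for it

Cell `pub/hodgecm-mathlib`, crux H413 = `stmt-HodgeConjecture-24833`.  THEOREMS ONLY (no `def`, no `instance`, no notation, no named-fact hypothesis, no `sorry`); lane `--supports
stmt-HodgeConjecture-24833 --as helper` (count-neutral).  Closes no socket.  §1 generic `GL_n(K ⊗ ℝ)`; §2–§3 generic `(F, E, c)`, every rank `N`.

THE MATHEMATICS ([Bump1997, proof of Lemma 2.3.2]; [Garrett2018, §7.3]; [BorelJacquet1979, §4.1]).  ★ `archBump φ` is `≥ 0`, `= 1` at `1`, symmetric, `Ad K_∞`-invariant, continuous, smooth along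
`expGL`; §1 adds: compact support (`{Q(x−1) ≤ r, Q(x⁻¹−1) ≤ r}` bounds `x` and `x⁻¹`, closed embedding `x ↦ (x, x⁻¹)`) and support inside any neighbourhood of `1` for small `φ.rOut`
(coercivity of `Q`, `Units.isOpenEmbedding_val`).  §2: `η := adelicWeight U₀ (archBump φ)` for an open compact `U₀ ≤ GL_N(𝔸_E^∞)` is `IsTestFunctionGL`, `≥ 0`, `η(1) = 1`, symmetric, and its
pull-back to `U(J_N)(𝔸_F)` is the pure tensor `α(y_∞)·𝟙_U(y_f)` (`α := archBump φ ∘ (G_∞ ↪ GL_N(E ⊗ ℝ))`, `U := {b | b ∈ U₀}`).  §3: the self-convolution `h = η̃ ∗ η̃` (★ `orbitalSmoothing`) is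
the pure tensor `h(y) = h_∞(y_∞)·𝟙_U(y_f)` with `h_∞ := κ·μ_f(U)·(α ∗ α)` (★ Fubini `exists_integral_eq_smul_integral_adelicProdEquiv`, `integral_prod_mul`, `U` a subgroup) — 12d-C's `hten` —
and `h_∞(k⁻¹ a k) = h_∞(a)` for `k ∈ K_∞` (two-sided `μ_∞`, `Ad`-invariance of `α`) — 12d-C's `hcent`; §4: the archimedean factor is real, `≥ 0`, positive at `1`, `α|_{G_∞} ∈ C_c`.
* §1 `hsQ_inv_sub_one_lt_of_archBump_ne_zero`, `isCompact_setOf_hsQ_sub_one_le`, **`hasCompactSupport_archBump`**, **`exists_forall_archBump_ne_zero_mem`**.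
* §2 `gaugeWeight_apply`, **`isTestFunctionGL_gaugeWeight`**, `gaugeWeight_nonneg`, `gaugeWeight_one`, `gaugeWeight_inv`, **`gaugeWeight_adelicVal`** (pure tensor on `U(J_N)(𝔸_F)`).
* §3 `integral_indicator_mul_indicator_inv_mul`, **`selfConv_gaugeWeight_eq_pureTensor`** (`hten`), `integral_mul_apply_inv_mul_conj`, `archBump_coe_conj`, **`archSelfConv_conj`** (`hcent`).
* §4 `integral_archBump_mul_eq_ofReal`, `integral_archBump_mul_nonneg`, `hasCompactSupport_archBump_coe`, **`integral_archBump_mul_one_pos`**.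
HONEST LABEL: HC_CM is proved only modulo the 7 printed citations (2 remaining named inputs: hLiu418 = `stmt-HodgeConjecture-24832`, h413 = `stmt-HodgeConjecture-24833`) until rung 0
closes; count-neutral helper, closes no socket.

## References
* [Bump1997] D. Bump, *Automorphic Forms and Representations* (1997), proof of Lemma 2.3.2.  * [Garrett2018] P. Garrett, *Modern Analysis of Automorphic Forms by Example* (2018), §7.3.
* [BorelJacquet1979] A. Borel, H. Jacquet, *Automorphic forms and automorphic representations*, Proc. Symp. Pure Math. 33.1 (1979), §4.1.
-/

set_option autoImplicit false
set_option linter.dupNamespace false  -- the mandated namespace repeats the summit's segment (`HodgeConjecture.HodgeConjecture`)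

noncomputable section

open MeasureTheory Measure NumberField NumberField.mixedEmbedding IsDedekindDomain Set Filter Topology
open scoped NNReal MatrixGroups Matrix ContDiff Classical Pointwise
open Literature.NumberTheory Literature.NumberTheory.Automorphic Literature.NumberTheory.Automorphic.UnitaryGroup AdelicGroupData
open Summit.HodgeConjecture.HodgeConjecture.Cruxes.H413.K2E1SphericalTestFunctionGL (exists_norm_le_of_hsQ_le)

namespace Summit.HodgeConjecture.HodgeConjecture.Cruxes.H413.K2E1ArchPureTensorSelfConvolutionU2

/-! ## §1 ★ `archBump`: compact support, and support inside any neighbourhood of `1` -/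

section ArchBumpSupport

variable {n : ℕ} {K : Type} [Field K] [NumberField K] (φ : ContDiffBump (0 : ℝ))

open scoped Matrix.Norms.Operator

/-- `α(x) ≠ 0 ⟹ Q(x⁻¹ − 1) < φ.rOut` (symmetry ★ `archBump_inv` + ★ `hsQ_lt_of_archBump_ne_zero`). [folklore] -/
theorem hsQ_inv_sub_one_lt_of_archBump_ne_zero {x : GL (Fin n) (mixedSpace K)} (hx : archBump φ x ≠ 0) :
    hsQ (((x⁻¹ : GL (Fin n) (mixedSpace K)) : Matrix (Fin n) (Fin n) (mixedSpace K)) - 1) < φ.rOut :=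
  hsQ_lt_of_archBump_ne_zero φ (by rwa [archBump_inv])

set_option backward.isDefEq.respectTransparency false in
/-- **`{x : Q(x − 1) ≤ r ∧ Q(x⁻¹ − 1) ≤ r}` IS COMPACT in `GL_n(K ⊗ ℝ)`** (both `x` and `x⁻¹` are bounded — ★ `exists_norm_le_of_hsQ_le` — so the image under the closed embedding `x ↦ (x, x⁻¹)` is a closed subset
of a product of closed balls; pattern of ★ P5c FILE A `isCompact_setOf_hsQ_defect_le`). [folklore] -/
theorem isCompact_setOf_hsQ_sub_one_le (r : ℝ) :
    IsCompact {x : GL (Fin n) (mixedSpace K) | hsQ ((x : Matrix (Fin n) (Fin n) (mixedSpace K)) - 1) ≤ r ∧ hsQ (((x⁻¹ : GL (Fin n) (mixedSpace K)) : Matrix (Fin n) (Fin n) (mixedSpace K)) - 1) ≤ r} := by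
  haveI : FiniteDimensional ℝ (Matrix (Fin n) (Fin n) (mixedSpace K)) := finiteDimensional_matrix_mixedSpace
  haveI : ProperSpace (Matrix (Fin n) (Fin n) (mixedSpace K)) := FiniteDimensional.proper ℝ _
  obtain ⟨C, hC⟩ := exists_norm_le_of_hsQ_le (n := n) (K := K) r
  set S : Set (GL (Fin n) (mixedSpace K)) := {x | hsQ ((x : Matrix (Fin n) (Fin n) (mixedSpace K)) - 1) ≤ r ∧ hsQ (((x⁻¹ : GL (Fin n) (mixedSpace K)) : Matrix (Fin n) (Fin n) (mixedSpace K)) - 1) ≤ r} with hS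
  have hc1 : Continuous fun x : GL (Fin n) (mixedSpace K) => hsQ ((x : Matrix (Fin n) (Fin n) (mixedSpace K)) - 1) := continuous_hsQ.comp (Units.continuous_val.sub continuous_const)
  have hc2 : Continuous fun x : GL (Fin n) (mixedSpace K) => hsQ (((x⁻¹ : GL (Fin n) (mixedSpace K)) : Matrix (Fin n) (Fin n) (mixedSpace K)) - 1) :=
    continuous_hsQ.comp (Units.continuous_coe_inv.sub continuous_const)
  have hSc : IsClosed S := (isClosed_le hc1 continuous_const).inter (isClosed_le hc2 continuous_const)
  set B : Set (Matrix (Fin n) (Fin n) (mixedSpace K) × (Matrix (Fin n) (Fin n) (mixedSpace K))ᵐᵒᵖ) :=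
    Metric.closedBall 1 C ×ˢ (MulOpposite.op '' Metric.closedBall 1 C) with hB
  have hBc : IsCompact B := (isCompact_closedBall _ _).prod ((isCompact_closedBall _ _).image MulOpposite.continuous_op)
  have hsub : Units.embedProduct (Matrix (Fin n) (Fin n) (mixedSpace K)) '' S ⊆ B := by
    rintro _ ⟨x, hx, rfl⟩
    refine ⟨?_, ⟨_, ?_, rfl⟩⟩
    · show (x : Matrix (Fin n) (Fin n) (mixedSpace K)) ∈ Metric.closedBall 1 C
      rw [mem_closedBall_iff_norm]; exact hC _ hx.1
    · rw [mem_closedBall_iff_norm]; exact hC _ hx.2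
  have hclosed : IsClosed (Units.embedProduct (Matrix (Fin n) (Fin n) (mixedSpace K)) '' S) := Units.isClosedEmbedding_embedProduct.isClosedMap _ hSc
  exact Units.isEmbedding_embedProduct.isCompact_iff.2 (hBc.of_isClosed_subset hclosed hsub)

/-- **`archBump φ` HAS COMPACT SUPPORT** (inside `{Q(x−1) ≤ r, Q(x⁻¹−1) ≤ r}`, `r = φ.rOut`). [folklore] -/
theorem hasCompactSupport_archBump : HasCompactSupport (archBump (n := n) (K := K) φ) :=
  HasCompactSupport.of_support_subset_isCompact (isCompact_setOf_hsQ_sub_one_le (n := n) (K := K) φ.rOut)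
    fun _ hx => ⟨(hsQ_lt_of_archBump_ne_zero φ (Function.mem_support.1 hx)).le, (hsQ_inv_sub_one_lt_of_archBump_ne_zero φ (Function.mem_support.1 hx)).le⟩

set_option backward.isDefEq.respectTransparency false in
/-- **SUPPORT INSIDE ANY NEIGHBOURHOOD OF `1`**: for `W ∈ 𝓝 1` in `GL_n(K ⊗ ℝ)` there is `r > 0` such that every bump with `φ.rOut ≤ r` has `α_φ(x) ≠ 0 ⟹ x ∈ W` (units are open in `M_n(K ⊗ ℝ)`,
`Units.isOpenEmbedding_val`; coercivity ★ `exists_hsQ_lt_imp_norm_lt`). [cite: Bump1997, proof of Lemma 2.3.2] -/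
theorem exists_forall_archBump_ne_zero_mem {W : Set (GL (Fin n) (mixedSpace K))} (hW : W ∈ 𝓝 (1 : GL (Fin n) (mixedSpace K))) :
    ∃ r : ℝ, 0 < r ∧ ∀ ψ : ContDiffBump (0 : ℝ), ψ.rOut ≤ r → ∀ x : GL (Fin n) (mixedSpace K), archBump ψ x ≠ 0 → x ∈ W := by
  have hW' : (Units.val '' W) ∈ 𝓝 (1 : Matrix (Fin n) (Fin n) (mixedSpace K)) := by
    have h := (Units.isOpenEmbedding_val (R := Matrix (Fin n) (Fin n) (mixedSpace K))).image_mem_nhds.2 hW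
    rwa [Units.val_one] at h
  obtain ⟨ε₀, hε₀, hball⟩ := Metric.mem_nhds_iff.1 hW'
  obtain ⟨r, hr, hrε⟩ := exists_hsQ_lt_imp_norm_lt (n := n) (K := K) hε₀
  refine ⟨r, hr, fun ψ hψ x hx => ?_⟩
  have h1 : ‖(x : Matrix (Fin n) (Fin n) (mixedSpace K)) - 1‖ < ε₀ := hrε _ ((hsQ_lt_of_archBump_ne_zero ψ hx).trans_le hψ)
  have hxb : (x : Matrix (Fin n) (Fin n) (mixedSpace K)) ∈ Metric.ball 1 ε₀ := by rwa [Metric.mem_ball, dist_eq_norm]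
  obtain ⟨u, hu, hueq⟩ := hball hxb
  rwa [← Units.ext hueq]

end ArchBumpSupport

/-! ## §2 The gauge test function `η = adelicWeight U₀ (archBump φ)` on `GL_N(𝔸_E)` and its pull-back to `U(J_N)(𝔸_F)` -/

section GaugeWeight

variable {N : ℕ} {E : Type} [Field E] [NumberField E] (φ : ContDiffBump (0 : ℝ)) (U₀ : Subgroup (GL (Fin N) (FiniteAdeleRing (𝓞 E) E)))

/-- `η(g) = α_φ(g_∞)·𝟙[g_f ∈ U₀]` (★ `adelicWeight_apply`). [cite: Garrett2018, §7.3] -/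
theorem gaugeWeight_apply (g : GL (Fin N) (AdeleRing (𝓞 E) E)) :
    adelicWeight U₀ (archBump φ) g = archBump φ (GLn.toMixed N E g) * (if GLn.sndHom N E g ∈ U₀ then 1 else 0) := by
  rw [adelicWeight_apply, Set.indicator_apply]
  rfl

set_option backward.isDefEq.respectTransparency false in
open scoped Matrix.Norms.Operator in
/-- **`η` IS A `GL_N(𝔸_E)` TEST FUNCTION** for an open compact `U₀` (★ `isTestFunctionGL_adelicWeight` with ★ `continuous_archBump`, §1 `hasCompactSupport_archBump`, ★ `contDiff_archBump_mul_expGL`).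
[cite: Garrett2018, §7.3] [cite: Bump1997, proof of Lemma 2.3.2] -/
theorem isTestFunctionGL_gaugeWeight (hU₀ : IsOpen (U₀ : Set (GL (Fin N) (FiniteAdeleRing (𝓞 E) E)))) (hU₀c : IsCompact (U₀ : Set (GL (Fin N) (FiniteAdeleRing (𝓞 E) E)))) :
    IsTestFunctionGL N E (adelicWeight U₀ (archBump φ)) := by
  letI : LieRing (Matrix (Fin N) (Fin N) (mixedSpace E)) := LieRing.ofAssociativeRing
  have hval : ContDiff ℝ ∞ fun X : (archGroupGL N E).lie.toSubmodule => (X : Matrix (Fin N) (Fin N) (mixedSpace E)) :=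
    (archGroupGL N E).lie.toSubmodule.subtypeL.contDiff
  exact isTestFunctionGL_adelicWeight hU₀ hU₀c (continuous_archBump φ) (hasCompactSupport_archBump φ) fun u => (contDiff_archBump_mul_expGL φ u).comp hval

/-- `η ≥ 0`. [folklore] -/
theorem gaugeWeight_nonneg (g : GL (Fin N) (AdeleRing (𝓞 E) E)) : 0 ≤ adelicWeight U₀ (archBump φ) g := by
  rw [gaugeWeight_apply]
  exact mul_nonneg (archBump_nonneg φ _) (by split_ifs <;> norm_num)

/-- `η(1) = 1`. [folklore] -/
theorem gaugeWeight_one : adelicWeight U₀ (archBump φ) (1 : GL (Fin N) (AdeleRing (𝓞 E) E)) = 1 := by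
  rw [gaugeWeight_apply, map_one, map_one, archBump_one, if_pos U₀.one_mem, mul_one]

/-- **`η(g⁻¹) = η(g)`** (★ `archBump_inv`; `g_f⁻¹ ∈ U₀ ↔ g_f ∈ U₀`). [cite: Bump1997, proof of Lemma 2.3.2] -/
theorem gaugeWeight_inv (g : GL (Fin N) (AdeleRing (𝓞 E) E)) : adelicWeight U₀ (archBump φ) (g⁻¹ : GL (Fin N) (AdeleRing (𝓞 E) E)) = adelicWeight U₀ (archBump φ) g := by
  rw [gaugeWeight_apply, gaugeWeight_apply, map_inv, map_inv, archBump_inv]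
  congr 1
  simp only [Subgroup.inv_mem_iff]

variable {F : Type} [Field F] [NumberField F] [Algebra F E] {c : E ≃ₐ[F] E} [NeZero N]

omit [NeZero N] in
/-- **PULL-BACK TO `U(J_N)(𝔸_F)` IS A PURE TENSOR**: `η(val y) = α(y_∞)·𝟙_U(y_f)` with `α a := archBump φ a` on `G_∞ ≤ GL_N(E ⊗ ℝ)` and `U := U₀ ∩ G(𝔸_f)` (`U₀.subgroupOf`; ★ `coe_archPart`, `coe_finPart`),
as a COMPLEX pure tensor — the shape 12d-C's `hten` wants. [cite: Garrett2018, §7.3] -/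
theorem gaugeWeight_adelicVal (y : (quasiSplit F E c N).Adelic) :
    (((adelicWeight U₀ (archBump φ) (adelicVal F E c N ((StdForm.antidiagonal N).over E) y) : ℝ)) : ℂ) =
      ((archBump φ ((archPart F E c N ((StdForm.antidiagonal N).over E) y : arch F E c N ((StdForm.antidiagonal N).over E)) : GL (Fin N) (mixedSpace E)) : ℝ) : ℂ) *
        ((U₀.subgroupOf (finAdelic F E c N ((StdForm.antidiagonal N).over E)) : Subgroup (finAdelic F E c N ((StdForm.antidiagonal N).over E))) :
          Set (finAdelic F E c N ((StdForm.antidiagonal N).over E))).indicator (fun _ => (1 : ℂ)) (finPart F E c N ((StdForm.antidiagonal N).over E) y) := by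
  rw [gaugeWeight_apply, Set.indicator_apply]
  by_cases hy : finPart F E c N ((StdForm.antidiagonal N).over E) y ∈ U₀.subgroupOf (finAdelic F E c N ((StdForm.antidiagonal N).over E))
  · have hy' : GLn.sndHom N E (adelicVal F E c N ((StdForm.antidiagonal N).over E) y) ∈ U₀ := Subgroup.mem_subgroupOf.1 hy
    rw [if_pos hy', if_pos (SetLike.mem_coe.2 hy), mul_one, mul_one]
    rfl
  · have hy' : GLn.sndHom N E (adelicVal F E c N ((StdForm.antidiagonal N).over E) y) ∉ U₀ := fun h => hy (Subgroup.mem_subgroupOf.2 h)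
    rw [if_neg hy', if_neg (fun h => hy (SetLike.mem_coe.1 h)), mul_zero, mul_zero, Complex.ofReal_zero]

end GaugeWeight

/-! ## §3 The self-convolution of `η̃ = η ∘ val` on `U(J_N)(𝔸_F)` is the pure tensor `κ·μ_f(U)·(α ∗ α) ⊗ 𝟙_U`; `K_∞`-centrality; positivity -/

section SelfConv

variable {F E : Type} [Field F] [NumberField F] [Field E] [NumberField E] [Algebra F E] {c : E ≃ₐ[F] E} {N : ℕ}
variable [MeasurableSpace (quasiSplit F E c N).Adelic] [BorelSpace (quasiSplit F E c N).Adelic]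
variable [MeasurableSpace (arch F E c N ((StdForm.antidiagonal N).over E))] [BorelSpace (arch F E c N ((StdForm.antidiagonal N).over E))]
variable [MeasurableSpace (finAdelic F E c N ((StdForm.antidiagonal N).over E))] [BorelSpace (finAdelic F E c N ((StdForm.antidiagonal N).over E))]
variable (νG : Measure (quasiSplit F E c N).Adelic) [νG.IsHaarMeasure]
variable (μa : Measure (arch F E c N ((StdForm.antidiagonal N).over E))) [μa.IsHaarMeasure]
variable (μf : Measure (finAdelic F E c N ((StdForm.antidiagonal N).over E))) [μf.IsHaarMeasure]
variable (φ : ContDiffBump (0 : ℝ)) (U₀ : Subgroup (GL (Fin N) (FiniteAdeleRing (𝓞 E) E)))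

omit [NumberField F] [MeasurableSpace (quasiSplit F E c N).Adelic] [BorelSpace (quasiSplit F E c N).Adelic] [MeasurableSpace (arch F E c N ((StdForm.antidiagonal N).over E))]
  [BorelSpace (arch F E c N ((StdForm.antidiagonal N).over E))] [BorelSpace (finAdelic F E c N ((StdForm.antidiagonal N).over E))] [μf.IsHaarMeasure] in
/-- `∫ 𝟙_U(b)·𝟙_U(b⁻¹ y_f) dμ_f(b) = μ_f(U)·𝟙_U(y_f)` for a subgroup `U` (measurable). [folklore] -/
theorem integral_indicator_mul_indicator_inv_mul (U : Subgroup (finAdelic F E c N ((StdForm.antidiagonal N).over E))) (hU : MeasurableSet (U : Set (finAdelic F E c N ((StdForm.antidiagonal N).over E))))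
    (yf : finAdelic F E c N ((StdForm.antidiagonal N).over E)) :
    ∫ b, (U : Set _).indicator (fun _ => (1 : ℂ)) b * (U : Set _).indicator (fun _ => (1 : ℂ)) (b⁻¹ * yf) ∂μf =
      (μf.real (U : Set _) : ℂ) * (U : Set _).indicator (fun _ => (1 : ℂ)) yf := by
  have hpt : ∀ b, (U : Set _).indicator (fun _ => (1 : ℂ)) b * (U : Set _).indicator (fun _ => (1 : ℂ)) (b⁻¹ * yf) =
      (U : Set _).indicator (fun _ => (1 : ℂ)) b * (U : Set _).indicator (fun _ => (1 : ℂ)) yf := by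
    intro b
    by_cases hb : b ∈ (U : Set (finAdelic F E c N ((StdForm.antidiagonal N).over E)))
    · have hiff : b⁻¹ * yf ∈ (U : Set (finAdelic F E c N ((StdForm.antidiagonal N).over E))) ↔ yf ∈ (U : Set (finAdelic F E c N ((StdForm.antidiagonal N).over E))) := by
        simp only [SetLike.mem_coe] at hb ⊢
        exact ⟨fun h => by simpa only [mul_inv_cancel_left] using U.mul_mem hb h, fun h => U.mul_mem (U.inv_mem hb) h⟩
      by_cases hy : yf ∈ (U : Set (finAdelic F E c N ((StdForm.antidiagonal N).over E)))
      · rw [Set.indicator_of_mem (hiff.2 hy), Set.indicator_of_mem hy]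
      · rw [Set.indicator_of_notMem (fun h => hy (hiff.1 h)), Set.indicator_of_notMem hy]
    · rw [Set.indicator_of_notMem hb, zero_mul, zero_mul]
  simp_rw [hpt]
  rw [integral_mul_const, integral_indicator_const _ hU, Complex.real_smul, mul_one]

/-- **12d-C's `hten` FOR `h = η̃ ∗ η̃`** (`η̃ = η ∘ val`, `η = adelicWeight U₀ (archBump φ)`, `U₀` open and compact): with `α := archBump φ|_{G_∞}`, `U := U₀ ∩ G(𝔸_f)` and some `κ > 0` (★ product Haar),
`(η̃ ∗ η̃)(y) = h_∞(y_∞)·𝟙_U(y_f)` for EVERY `y`, `h_∞(a) := κ·μ_f(U)·∫ α(x)α(x⁻¹a) dμ_∞(x)` — ★ Fubini `exists_integral_eq_smul_integral_adelicProdEquiv`, the pure-tensor formula §2 (via the HOMS `archPart`,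
`finPart`), `integral_prod_mul`, and `∫ 𝟙_U(b)𝟙_U(b⁻¹y_f) = μ_f(U)𝟙_U(y_f)`. [cite: BorelJacquet1979, §4.1] [cite: Garrett2018, §7.3] -/
theorem selfConv_gaugeWeight_eq_pureTensor (hU₀ : IsOpen (U₀ : Set (GL (Fin N) (FiniteAdeleRing (𝓞 E) E)))) :
    ∃ κ : ℝ≥0, 0 < κ ∧ ∀ y : (quasiSplit F E c N).Adelic,
      orbitalSmoothing νG (fun x : (quasiSplit F E c N).Adelic => (((adelicWeight U₀ (archBump φ) (adelicVal F E c N ((StdForm.antidiagonal N).over E) x) : ℝ)) : ℂ))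
          (fun x : (quasiSplit F E c N).Adelic => (((adelicWeight U₀ (archBump φ) (adelicVal F E c N ((StdForm.antidiagonal N).over E) x) : ℝ)) : ℂ)) y =
        (fun a : arch F E c N ((StdForm.antidiagonal N).over E) => ((κ : ℝ) : ℂ) * (μf.real ((U₀.subgroupOf (finAdelic F E c N ((StdForm.antidiagonal N).over E)) : Subgroup _) : Set _) : ℂ) *
            ∫ x, ((archBump φ ((x : arch F E c N ((StdForm.antidiagonal N).over E)) : GL (Fin N) (mixedSpace E)) : ℝ) : ℂ) *
              ((archBump φ ((x⁻¹ * a : arch F E c N ((StdForm.antidiagonal N).over E)) : GL (Fin N) (mixedSpace E)) : ℝ) : ℂ) ∂μa) (archPart F E c N _ y) *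
          ((U₀.subgroupOf (finAdelic F E c N ((StdForm.antidiagonal N).over E)) : Subgroup _) : Set (finAdelic F E c N ((StdForm.antidiagonal N).over E))).indicator (fun _ => (1 : ℂ))
            (finPart F E c N _ y) := by
  letI : MeasurableSpace (adelic F E c N ((StdForm.antidiagonal N).over E)) := ‹MeasurableSpace (quasiSplit F E c N).Adelic›
  haveI : BorelSpace (adelic F E c N ((StdForm.antidiagonal N).over E)) := ⟨‹BorelSpace (quasiSplit F E c N).Adelic›.measurable_eq⟩
  haveI : @Measure.IsHaarMeasure (↥(adelic F E c N ((StdForm.antidiagonal N).over E))) _ _ _ νG :=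
    { lt_top_of_isCompact := fun K hK => IsFiniteMeasureOnCompacts.lt_top_of_isCompact (μ := νG) hK
      map_mul_left_eq_self := fun g => map_mul_left_eq_self νG g
      open_pos := fun U hU hne => IsOpenPosMeasure.open_pos (μ := νG) U hU hne }
  obtain ⟨κ, hκ, hFub⟩ := exists_integral_eq_smul_integral_adelicProdEquiv F E c N ((StdForm.antidiagonal N).over E) νG μa μf
  haveI := sFinite_haar_finAdelic F E c N ((StdForm.antidiagonal N).over E) μf
  have hUmeas : MeasurableSet ((U₀.subgroupOf (finAdelic F E c N ((StdForm.antidiagonal N).over E)) : Subgroup _) : Set (finAdelic F E c N ((StdForm.antidiagonal N).over E))) :=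
    (hU₀.preimage continuous_subtype_val).measurableSet
  refine ⟨κ, hκ, fun y => ?_⟩
  set U : Set (finAdelic F E c N ((StdForm.antidiagonal N).over E)) := ↑(U₀.subgroupOf (finAdelic F E c N ((StdForm.antidiagonal N).over E))) with hUdef
  set α : arch F E c N ((StdForm.antidiagonal N).over E) → ℂ := fun a => ((archBump φ ((a : arch F E c N ((StdForm.antidiagonal N).over E)) : GL (Fin N) (mixedSpace E)) : ℝ) : ℂ) with hα
  set ηt : (quasiSplit F E c N).Adelic → ℂ := fun x => (((adelicWeight U₀ (archBump φ) (adelicVal F E c N ((StdForm.antidiagonal N).over E) x) : ℝ)) : ℂ) with hηt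
  -- the integrand on `G_∞ × G(𝔸_f)`
  have hint : ∀ p : arch F E c N ((StdForm.antidiagonal N).over E) × finAdelic F E c N ((StdForm.antidiagonal N).over E),
      ηt (archToAdelic F E c N _ p.1 * finAdelicToAdelic F E c N _ p.2) * ηt ((archToAdelic F E c N _ p.1 * finAdelicToAdelic F E c N _ p.2)⁻¹ * y) =
        (α p.1 * α (p.1⁻¹ * archPart F E c N _ y)) * (U.indicator (fun _ => (1 : ℂ)) p.2 * U.indicator (fun _ => (1 : ℂ)) (p.2⁻¹ * finPart F E c N _ y)) := by
    rintro ⟨a, b⟩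
    simp only [hηt]
    rw [gaugeWeight_adelicVal, gaugeWeight_adelicVal]
    simp only [map_mul, map_inv, archPart_archToAdelic, archPart_finAdelicToAdelic, finPart_archToAdelic, finPart_finAdelicToAdelic, mul_one, one_mul, hα, hUdef]
    ring
  have step1 : ∫ g, ηt g • ηt (g⁻¹ • y) ∂νG =
      (κ : ℝ) • ∫ p : arch F E c N ((StdForm.antidiagonal N).over E) × finAdelic F E c N ((StdForm.antidiagonal N).over E),
        ηt (archToAdelic F E c N _ p.1 * finAdelicToAdelic F E c N _ p.2) • ηt ((archToAdelic F E c N _ p.1 * finAdelicToAdelic F E c N _ p.2)⁻¹ • y) ∂(μa.prod μf) :=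
    hFub (fun g : (quasiSplit F E c N).Adelic => ηt g • ηt (g⁻¹ • y))
  have step2 : ∫ p : arch F E c N ((StdForm.antidiagonal N).over E) × finAdelic F E c N ((StdForm.antidiagonal N).over E),
      (α p.1 * α (p.1⁻¹ * archPart F E c N _ y)) * (U.indicator (fun _ => (1 : ℂ)) p.2 * U.indicator (fun _ => (1 : ℂ)) (p.2⁻¹ * finPart F E c N _ y)) ∂(μa.prod μf) =
        (∫ a, α a * α (a⁻¹ * archPart F E c N _ y) ∂μa) * ∫ b, U.indicator (fun _ => (1 : ℂ)) b * U.indicator (fun _ => (1 : ℂ)) (b⁻¹ * finPart F E c N _ y) ∂μf :=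
    integral_prod_mul (fun a => α a * α (a⁻¹ * archPart F E c N _ y)) (fun b => U.indicator (fun _ => (1 : ℂ)) b * U.indicator (fun _ => (1 : ℂ)) (b⁻¹ * finPart F E c N _ y))
  unfold orbitalSmoothing
  rw [step1]
  simp only [smul_eq_mul]
  rw [integral_congr_ae (Eventually.of_forall hint), step2, integral_indicator_mul_indicator_inv_mul μf _ hUmeas, Complex.real_smul]
  ring

omit [NumberField F] [NumberField E] [MeasurableSpace (quasiSplit F E c N).Adelic] [BorelSpace (quasiSplit F E c N).Adelic] [MeasurableSpace (finAdelic F E c N ((StdForm.antidiagonal N).over E))]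
  [BorelSpace (finAdelic F E c N ((StdForm.antidiagonal N).over E))] [μa.IsHaarMeasure] in
/-- Generic: for a conjugation-invariant `α` on `G_∞` (`α(k⁻¹xk) = α(x)`) and a two-sided invariant `μ_∞`, `∫ α(x)α(x⁻¹·k⁻¹ak) dμ_∞ = ∫ α(x)α(x⁻¹a) dμ_∞` (substitute `x ↦ k⁻¹xk`). [folklore] -/
theorem integral_mul_apply_inv_mul_conj [μa.IsMulLeftInvariant] [μa.IsMulRightInvariant] {α : arch F E c N ((StdForm.antidiagonal N).over E) → ℂ}
    {k : arch F E c N ((StdForm.antidiagonal N).over E)} (hα : ∀ x, α (k⁻¹ * x * k) = α x) (a : arch F E c N ((StdForm.antidiagonal N).over E)) :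
    ∫ x, α x * α (x⁻¹ * (k⁻¹ * a * k)) ∂μa = ∫ x, α x * α (x⁻¹ * a) ∂μa := by
  have e1 := integral_mul_left_eq_self (μ := μa) (fun x => α x * α (x⁻¹ * (k⁻¹ * a * k))) k⁻¹
  have e2 := integral_mul_right_eq_self (μ := μa) (fun x => α (k⁻¹ * x) * α ((k⁻¹ * x)⁻¹ * (k⁻¹ * a * k))) k
  rw [← e1, ← e2]
  refine integral_congr_ae (Eventually.of_forall fun x => ?_)
  show α (k⁻¹ * (x * k)) * α ((k⁻¹ * (x * k))⁻¹ * (k⁻¹ * a * k)) = α x * α (x⁻¹ * a)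
  rw [show k⁻¹ * (x * k) = k⁻¹ * x * k by group, show (k⁻¹ * x * k)⁻¹ * (k⁻¹ * a * k) = k⁻¹ * (x⁻¹ * a) * k by group, hα, hα]

omit [MeasurableSpace (quasiSplit F E c N).Adelic] [BorelSpace (quasiSplit F E c N).Adelic] [MeasurableSpace (arch F E c N ((StdForm.antidiagonal N).over E))]
  [BorelSpace (arch F E c N ((StdForm.antidiagonal N).over E))] [MeasurableSpace (finAdelic F E c N ((StdForm.antidiagonal N).over E))] [BorelSpace (finAdelic F E c N ((StdForm.antidiagonal N).over E))] in
/-- `α := archBump φ|_{G_∞}` is conjugation-invariant under `K_∞ = (val⁻¹(K_∞·GL_N(𝒪̂)))∩G_∞` (`k` is unitary in `GL_N(E ⊗ ℝ)`; ★ `archBump_conj`). [cite: Bump1997, proof of Lemma 2.3.2] -/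
theorem archBump_coe_conj {k : arch F E c N ((StdForm.antidiagonal N).over E)}
    (hk : k ∈ (((standardMaximalCompactGL N E).comap (adelicVal F E c N ((StdForm.antidiagonal N).over E))).comap (archToAdelic F E c N ((StdForm.antidiagonal N).over E))))
    (x : arch F E c N ((StdForm.antidiagonal N).over E)) :
    archBump φ ((k⁻¹ * x * k : arch F E c N ((StdForm.antidiagonal N).over E)) : GL (Fin N) (mixedSpace E)) = archBump φ (x : GL (Fin N) (mixedSpace E)) := by
  have hk' : GLn.toMixed N E (adelicVal F E c N ((StdForm.antidiagonal N).over E) (archToAdelic F E c N _ k)) ∈ Kinf N E :=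
    ((mem_standardMaximalCompactGL_iff_toMixed_sndHom _).1 (Subgroup.mem_comap.1 (Subgroup.mem_comap.1 hk))).1
  rw [← coe_archPart, archPart_archToAdelic, Kinf_eq_unitarySubgroupGL, mem_unitarySubgroupGL_iff] at hk'
  -- `k⁻¹` is unitary as well
  have e := Summit.HodgeConjecture.HodgeConjecture.Cruxes.H413.K2E1SphericalTestFunctionGL.coe_inv_eq_conjTranspose hk'
  have hkinv : star ((((k : GL (Fin N) (mixedSpace E))⁻¹ : GL (Fin N) (mixedSpace E)) : Matrix (Fin N) (Fin N) (mixedSpace E))) * (((k : GL (Fin N) (mixedSpace E))⁻¹ : GL (Fin N) (mixedSpace E)) : Matrix (Fin N) (Fin N) (mixedSpace E)) = 1 := by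
    rw [e, Matrix.star_eq_conjTranspose, Matrix.conjTranspose_conjTranspose, ← e]
    exact Units.mul_inv _
  have h1 : ((k⁻¹ * x * k : arch F E c N ((StdForm.antidiagonal N).over E)) : GL (Fin N) (mixedSpace E)) =
      (k : GL (Fin N) (mixedSpace E))⁻¹ * (x : GL (Fin N) (mixedSpace E)) * ((k : GL (Fin N) (mixedSpace E))⁻¹)⁻¹ := by
    rw [inv_inv, Subgroup.coe_mul, Subgroup.coe_mul, Subgroup.coe_inv]
  rw [h1, archBump_conj φ hkinv]

omit [MeasurableSpace (quasiSplit F E c N).Adelic] [BorelSpace (quasiSplit F E c N).Adelic] [MeasurableSpace (finAdelic F E c N ((StdForm.antidiagonal N).over E))]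
  [BorelSpace (finAdelic F E c N ((StdForm.antidiagonal N).over E))] in
/-- **12d-C's `hcent` FOR `h_∞ = C·(α ∗ α)`**: `h_∞(k⁻¹ a k) = h_∞(a)` for `k ∈ K_∞` and two-sided `μ_∞`. [cite: Bump1997, proof of Lemma 2.3.2] -/
theorem archSelfConv_conj [μa.IsMulRightInvariant] (C : ℂ)
    {k : arch F E c N ((StdForm.antidiagonal N).over E)}
    (hk : k ∈ (((standardMaximalCompactGL N E).comap (adelicVal F E c N ((StdForm.antidiagonal N).over E))).comap (archToAdelic F E c N ((StdForm.antidiagonal N).over E))))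
    (a : arch F E c N ((StdForm.antidiagonal N).over E)) :
    (fun a : arch F E c N ((StdForm.antidiagonal N).over E) => C * ∫ x, ((archBump φ ((x : arch F E c N ((StdForm.antidiagonal N).over E)) : GL (Fin N) (mixedSpace E)) : ℝ) : ℂ) *
        ((archBump φ ((x⁻¹ * a : arch F E c N ((StdForm.antidiagonal N).over E)) : GL (Fin N) (mixedSpace E)) : ℝ) : ℂ) ∂μa) (k⁻¹ * a * k) =
      (fun a : arch F E c N ((StdForm.antidiagonal N).over E) => C * ∫ x, ((archBump φ ((x : arch F E c N ((StdForm.antidiagonal N).over E)) : GL (Fin N) (mixedSpace E)) : ℝ) : ℂ) *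
        ((archBump φ ((x⁻¹ * a : arch F E c N ((StdForm.antidiagonal N).over E)) : GL (Fin N) (mixedSpace E)) : ℝ) : ℂ) ∂μa) a := by
  simp only
  rw [integral_mul_apply_inv_mul_conj μa (α := fun x : arch F E c N ((StdForm.antidiagonal N).over E) => ((archBump φ ((x : arch F E c N ((StdForm.antidiagonal N).over E)) : GL (Fin N) (mixedSpace E)) : ℝ) : ℂ))
    (fun x => by simp only [archBump_coe_conj φ hk x]) a]

end SelfConv

/-! ## §4 The archimedean factor `a ↦ ∫ α(x)α(x⁻¹a) dμ_∞`: real, non-negative, positive at `1`, compactly supported -/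

section ArchFactor

variable {F E : Type} [Field F] [NumberField F] [Field E] [NumberField E] [Algebra F E] {c : E ≃ₐ[F] E} {N : ℕ}
variable [MeasurableSpace (arch F E c N ((StdForm.antidiagonal N).over E))]
variable (μa : Measure (arch F E c N ((StdForm.antidiagonal N).over E))) (φ : ContDiffBump (0 : ℝ))

omit [NumberField F] in
/-- The complex archimedean factor is the real one: `∫ ↑α(x)·↑α(x⁻¹a) = ↑(∫ α(x)α(x⁻¹a))`. [folklore] -/
theorem integral_archBump_mul_eq_ofReal (a : arch F E c N ((StdForm.antidiagonal N).over E)) :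
    ∫ x, ((archBump φ ((x : arch F E c N ((StdForm.antidiagonal N).over E)) : GL (Fin N) (mixedSpace E)) : ℝ) : ℂ) *
        ((archBump φ ((x⁻¹ * a : arch F E c N ((StdForm.antidiagonal N).over E)) : GL (Fin N) (mixedSpace E)) : ℝ) : ℂ) ∂μa =
      (((∫ x, archBump φ ((x : arch F E c N ((StdForm.antidiagonal N).over E)) : GL (Fin N) (mixedSpace E)) *
        archBump φ ((x⁻¹ * a : arch F E c N ((StdForm.antidiagonal N).over E)) : GL (Fin N) (mixedSpace E)) ∂μa : ℝ)) : ℂ) := by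
  rw [← integral_complex_ofReal]
  refine integral_congr_ae (Eventually.of_forall fun x => ?_)
  simp only [Complex.ofReal_mul]

omit [NumberField F] in
/-- The real archimedean factor is `≥ 0` (`α ≥ 0`). [folklore] -/
theorem integral_archBump_mul_nonneg (a : arch F E c N ((StdForm.antidiagonal N).over E)) :
    0 ≤ ∫ x, archBump φ ((x : arch F E c N ((StdForm.antidiagonal N).over E)) : GL (Fin N) (mixedSpace E)) *
        archBump φ ((x⁻¹ * a : arch F E c N ((StdForm.antidiagonal N).over E)) : GL (Fin N) (mixedSpace E)) ∂μa :=
  integral_nonneg fun _ => mul_nonneg (archBump_nonneg φ _) (archBump_nonneg φ _)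

omit [NumberField F] [MeasurableSpace (arch F E c N ((StdForm.antidiagonal N).over E))] in
/-- `α|_{G_∞}` has compact support (`G_∞` is closed in `GL_N(E ⊗ ℝ)`, ★ `isClosed_arch`; §1 `hasCompactSupport_archBump`). [folklore] -/
theorem hasCompactSupport_archBump_coe :
    HasCompactSupport fun x : arch F E c N ((StdForm.antidiagonal N).over E) => archBump φ ((x : arch F E c N ((StdForm.antidiagonal N).over E)) : GL (Fin N) (mixedSpace E)) :=
  (hasCompactSupport_archBump φ).comp_isClosedEmbedding (isClosed_arch F E c N ((StdForm.antidiagonal N).over E)).isClosedEmbedding_subtypeVal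

omit [NumberField F] in
/-- **THE ARCHIMEDEAN FACTOR IS POSITIVE AT `1`**: `∫ α(x)α(x⁻¹) dμ_∞ = ∫ α(x)² dμ_∞ > 0` (`α` continuous of compact support, `α(1) = 1`, `μ_∞` positive on open sets). [folklore] -/
theorem integral_archBump_mul_one_pos [BorelSpace (arch F E c N ((StdForm.antidiagonal N).over E))] [IsFiniteMeasureOnCompacts μa] [μa.IsOpenPosMeasure] :
    0 < ∫ x, archBump φ ((x : arch F E c N ((StdForm.antidiagonal N).over E)) : GL (Fin N) (mixedSpace E)) *
        archBump φ ((x⁻¹ * 1 : arch F E c N ((StdForm.antidiagonal N).over E)) : GL (Fin N) (mixedSpace E)) ∂μa := by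
  have hc : Continuous fun x : arch F E c N ((StdForm.antidiagonal N).over E) => archBump φ ((x : arch F E c N ((StdForm.antidiagonal N).over E)) : GL (Fin N) (mixedSpace E)) :=
    (continuous_archBump φ).comp continuous_subtype_val
  simp_rw [mul_one, Subgroup.coe_inv, archBump_inv]
  refine (hc.mul hc).integral_pos_of_hasCompactSupport_nonneg_nonzero ((hasCompactSupport_archBump_coe φ).mul_left) (fun x => mul_nonneg (archBump_nonneg φ _) (archBump_nonneg φ _)) (x := 1) ?_
  rw [Subgroup.coe_one, archBump_one, mul_one]
  exact one_ne_zero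

end ArchFactor

end Summit.HodgeConjecture.HodgeConjecture.Cruxes.H413.K2E1ArchPureTensorSelfConvolutionU2
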